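import Summits.QuantumFields.YangMills.Theorems.UnitScaleTiltProp7SlotRowOfDeltaEta
import Summits.QuantumFields.YangMills.Theorems.UnitScaleTiltToronSectorStencils
import Summits.QuantumFields.YangMills.Theorems.UnitScaleTiltProp7SecondOrderDictT3
import HarnessLib

/-!
# Route `UnitScaleTilt`, crux K1 «MinimiserStabilityRegPr» (stmt-QuantumFields-19200), EX row `hGF` — the SMALL-MEMBER branch of the curved target `hT`,
# exit (α)(a) brick (3)-Hess — **THE WILSON HESSIAN `Δ^η_W` AT A FLAT BACKGROUND IS EXACTLY THE COVARIANT CURL FORM** (`Δ′ = 0` whenever every `W(∂p) = 1`),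
# **AND AT A TORON IT IS THE TWISTED SCALAR CURL FORM, ENTRY BY ENTRY**

Cell `ym3-torus` (HUMAN RULING D-0037: YM₃ on T³ is ladder rung R3 — NOT d = 4, NOT infinite volume, NOT a mass gap, NOT Clay).  Width seat `ym-routeR-w3` (gen 13),
OFFER 2026-08-30 03:22Z, px12 g14 «GO (3)-Hess» 03:23Z with pins (P-a)(P-b) (background letter `hU : ↑(W b) = diagonal (δ b.dir)`, unit phases `hδ`, twist
`ω_{rs,ν} := δ ν r · conj(δ ν s)`; entry algebra of ✓`Theorems/UnitScaleTiltToronSectorStencils` §1 reused by name).  THEOREMS ONLY (0 `def`, 0 `sorry`);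
`--supports stmt-QuantumFields-19200 --as helper`, count-neutral.  HONEST LABEL (★★OWNER RULING №33 (6)): rewriting of landed letters at a flat ∕ diagonal background;
nothing of the twisted coercivity (P1), the definition layer D1, `hT`, `hGF`, EX or the crux is proved here.

WHY.  The small-member exit (α)(a) (px10 g10 `LOCATE-SMALL-MEMBERS` §(vi), `LOCATE-(α)(a)-2` §3, 19200 evidence #57–#59) reads the member's quadratic form
`re⟪A, Δ^η_{U₀}A⟫ + ‖R_{Q″}D*_{U₀}A‖² + a‖Q_kA‖²` at a TORON `U₀` (after a global gauge, a small member of `𝔘_k(ε₀)` is a constant abelian background) sector by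
sector, each matrix entry `(r, s)` seeing a SCALAR operator twisted by the unit phase `ω_{rs}`.  The first-order letters `D_{U₀}`, `D*_{U₀}` and `Δ^η = D*D` on sites are
✓`ToronSectorStencils` §2–§4 (px12 g14); this file supplies the HESSIAN letter.  [Balaban1985BackgroundPropagators] (3.10): `Δ = D*D_U + Δ′`, the curvature part `Δ′`
carrying the weights `z(p) = η⁻²(Re U(∂p) − 1)` and `y(p) = η⁻²Im U(∂p)` (lit ✓`B9Eq310Hermitian.zP`∕`yP`∕`jordanF`∕`commGᵢ`∕`deltaPrimeOp`).  At a FLAT background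
(`U(∂p) = 1` for every plaquette) both weights vanish, so `Δ′ = 0` and `Δ^η_W = η⁻²D¹*_WD¹_W` EXACTLY — the tree had this only at `W ≡ 1` (✓`Prop7LaplaceAFlatLetters.deltaPrimeOp_one`,
lit's closing `example`s).  With px5's (3.10) split ✓`Prop7SlotRowOfDeltaEta.re_inner_toL2_DeltaEta_eq` (arbitrary `W`) the member's Hessian form at a flat `W` is the sum
of Frobenius squares of the covariant curl (§2); at a toron the covariant curl is, entry by entry, the scalar curl with the forward values twisted by `ω_{rs,μ}`, `ω_{rs,ν}` (§3).

WHAT IS PROVED (ns `…Theorems.FlatBackgroundWilsonHessian`).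
* §1 ([B9] letters over any ring `𝔸`, any shifts `T`, any background `U`): `zP_eq_zero_of_plaqU_eq_one`, `yP_eq_zero_of_plaqU_eq_one`; under
  `hflat : ∀ μ ν x, plaqU T U μ ν x = 1`: `jordanF_eq_zero_of_flat`, `commG₁∕₂∕₃∕₄_eq_zero_of_flat`, ★ `deltaPrimeOp_eq_zero_of_flat` (`Δ′ = 0`),
  ★ `deltaOp_eq_of_flat` (`Δ = D^{η*}D^η_U`).
* §2 (member `F, n, K`, weight `c₀ > 0`, background `W : GaugeField (F.P K) 0 SU(2)`, `T := torusT`, `U := fun μ x ↦ bgUnits F K W ⟨x, μ⟩`):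
  `plaqU_bgUnits_eq_one_of_plaqFT` (the flatness letter from the holonomy letter `plaqFT (bgUnits W) ≡ 1`);
  ★★ `DeltaEta_toL2_eq_of_flat` — `Δ^η_W(toL2 X) = toL2 (η⁻² • D¹*_WD¹_W X)` (no curvature part);
  ★★★ `re_inner_DeltaEta_eq_curlForm_of_flat` — `re⟪toL2 X, Δ^η_W(toL2 X)⟫ = c₀·η⁻²·Σ_{p : Plaq} ‖frobEquiv⁻¹((D¹_W X)(p))‖²`;
  ★ `re_inner_DeltaEta_nonneg_of_flat` — hence `0 ≤ re⟪toL2 X, Δ^η_W(toL2 X)⟫` at every flat background (EXACT; compare ✓`Prop7DeltaEtaAlmostPositive` on `RegPr`, which pays `O(ε₀)`).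
* §3 (toron: `hU : ∀ b, ↑(W b) = Matrix.diagonal (δ b.dir)`, `hδ : ∀ ν i, ‖δ ν i‖ = 1`): `val_bgUnits_of_dirDiagonal`, `val_inv_bgUnits_of_dirDiagonal` (the unit letters),
  ★ `plaqU_eq_one_of_dirDiagonal` (a direction-diagonal unit background is FLAT), ★★ `curl_apply_entry_of_dirDiagonal` —
  `((D¹_W X)(p_{μν}(x)))_{rs} = (ω_{rs,μ}·X(x+e_μ, ν)_{rs} − X(x, ν)_{rs}) − (ω_{rs,ν}·X(x+e_ν, μ)_{rs} − X(x, μ)_{rs})`,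
  `curl_apply_diagEntry_of_dirDiagonal` (diagonal entries = the FLAT curl `LatticeFieldCalculus.curl 1` of the scalar field `b ↦ X(b)_{rr}`),
  ★★★ `re_inner_DeltaEta_eq_of_dirDiagonal` — THE TORON HESSIAN: `re⟪toL2 X, Δ^η_W(toL2 X)⟫ = c₀·η⁻²·Σ_p Σ_{r,s} |twisted scalar curl_{rs}(p)|²`.
HONEST SCOPE.  Identities only; no estimate, no coercivity, nothing at a non-flat background; the `Q_k = QTwS`∕`topMean` toron sectors (P2's last brick) are NOT here.

References: T. Bałaban, CMP **99** (1985) 389–434 [Balaban1985BackgroundPropagators] ((3.1)–(3.5) pp.390–391, (3.9)–(3.12) p.392); CMP **95** (1984) 17–40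
[Balaban1984PropagatorsI] ((1.2) p.18, (1.29)–(1.31) p.23); CMP **102** (1985) 277–309 [Balaban1985Variational] ((19) p.281, p.299).
-/

set_option autoImplicit false

noncomputable section

open scoped Matrix.Norms.L2Operator BigOperators InnerProductSpace ComplexConjugate Matrix
open Complex (I)

namespace Summit.QuantumFields.YangMills.Theorems.FlatBackgroundWilsonHessian

open Literature.MathematicalPhysics.QuantumFieldTheory.Balaban1983to89
open Literature.MathematicalPhysics.QuantumFieldTheory.Balaban1983to89.T3ContinuumYM3Torus
open T3SectALandauChart (formComp bgUnits covCodiffCurlT eta eta_pos)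
open B9TorusCalculus (torusT torusT_apply)
open B9Eq37Insertion (reC imC reC_one imC_one)
open B9Eq39Adjoint (R R_zero covD covDstar curl plaqU divP curlη divPη)
open B9Eq310Hermitian (zP yP jordanF sgnSum₁ sgnSum₂ sgnSum₃ sgnSum₄ commG₁ commG₂ commG₃ commG₄ divL deltaPrimeOp deltaOp)
open B10Eq68TorusRegularity (plaqFT)
open B11Eq103H1Complex (BondL2K)
open Summit.QuantumFields.YangMills.Theorems.Prop7SectET3Transport (periodsT3)
open Summit.QuantumFields.YangMills.Theorems.Prop7SectET3HilbertLetters (W₂ frobEquiv toL2)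
open Summit.QuantumFields.YangMills.Theorems.Prop7SectET3WilsonHessian (DeltaEta)
open Summit.QuantumFields.YangMills.Theorems.Prop7SectET3DeltaEtaExplicit (val_inv_bgUnits_eq_star)
open Summit.QuantumFields.YangMills.Theorems.Prop7SlotRowOfDeltaEta (re_inner_toL2_DeltaEta_eq DeltaEta_toL2_eq_toL2)
open Summit.QuantumFields.YangMills.Theorems.Prop7RieszTauFrobNorm (norm_sq_frobEquiv_symm)
open Summit.QuantumFields.YangMills.Theorems.Prop7SecondOrderDict (val_plaqU_torusT_eq_plaqFT)
open Summit.QuantumFields.YangMills.Theorems.ToronSectorStencils (diagonal_conj_apply mul_conj_self_of_norm_eq_one)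

/-! ## §1 [B9] (3.10): at a flat background the curvature part `Δ′` vanishes identically -/

section B9Letters

variable {𝔸 : Type*} [Ring 𝔸] [Algebra ℂ 𝔸] {S : Type*} {ι : Type*}
variable (T : ι → Equiv.Perm S) (U : ι → S → 𝔸ˣ)

/-- `U(∂p) = 1 ⇒ z(p) = η⁻²(Re U(∂p) − 1) = 0`. [cite: Balaban1985BackgroundPropagators, (3.10) p.392] -/
theorem zP_eq_zero_of_plaqU_eq_one (η : ℝ) {μ ν : ι} {x : S} (h : plaqU T U μ ν x = 1) : zP T U η μ ν x = 0 := by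
  rw [zP, h, reC_one, sub_self, smul_zero]

/-- `U(∂p) = 1 ⇒ y(p) = η⁻²Im U(∂p) = 0`. [cite: Balaban1985BackgroundPropagators, (3.10)–(3.11) p.392] -/
theorem yP_eq_zero_of_plaqU_eq_one (η : ℝ) {μ ν : ι} {x : S} (h : plaqU T U μ ν x = 1) : yP T U η μ ν x = 0 := by
  rw [yP, h, imC_one, smul_zero]

variable {T U}

/-- At a flat background the Jordan-symmetrised first term of `Δ′` vanishes: `F^J_A ≡ 0`. [cite: Balaban1985BackgroundPropagators, (3.10) p.392] -/
theorem jordanF_eq_zero_of_flat (hflat : ∀ μ ν x, plaqU T U μ ν x = 1) (η : ℝ) (A : ι → S → 𝔸) : jordanF T U η A = 0 := by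
  funext μ ν x
  simp only [jordanF, zP_eq_zero_of_plaqU_eq_one T U η (hflat μ ν x), mul_zero, zero_mul, add_zero, smul_zero, Pi.zero_apply]

/-- At a flat background the commutator letter function `G₁ ≡ 0`. [cite: Balaban1985BackgroundPropagators, (3.10) p.392] -/
theorem commG₁_eq_zero_of_flat (hflat : ∀ μ ν x, plaqU T U μ ν x = 1) (η : ℝ) (A : ι → S → 𝔸) : commG₁ T U η A = 0 := by
  funext μ ν x
  simp only [commG₁, yP_eq_zero_of_plaqU_eq_one T U η (hflat μ ν x), mul_zero, zero_mul, sub_zero, smul_zero, Pi.zero_apply]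

/-- At a flat background `G₂ ≡ 0`. [cite: Balaban1985BackgroundPropagators, (3.10) p.392] -/
theorem commG₂_eq_zero_of_flat (hflat : ∀ μ ν x, plaqU T U μ ν x = 1) (η : ℝ) (A : ι → S → 𝔸) : commG₂ T U η A = 0 := by
  funext μ ν x
  simp only [commG₂, yP_eq_zero_of_plaqU_eq_one T U η (hflat μ ν x), mul_zero, zero_mul, sub_zero, smul_zero, Pi.zero_apply]

/-- At a flat background `G₃ ≡ 0`. [cite: Balaban1985BackgroundPropagators, (3.10) p.392] -/
theorem commG₃_eq_zero_of_flat (hflat : ∀ μ ν x, plaqU T U μ ν x = 1) (η : ℝ) (A : ι → S → 𝔸) : commG₃ T U η A = 0 := by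
  funext μ ν x
  simp only [commG₃, yP_eq_zero_of_plaqU_eq_one T U η (hflat μ ν x), mul_zero, zero_mul, sub_zero, smul_zero, Pi.zero_apply]

/-- At a flat background `G₄ ≡ 0`. [cite: Balaban1985BackgroundPropagators, (3.10) p.392] -/
theorem commG₄_eq_zero_of_flat (hflat : ∀ μ ν x, plaqU T U μ ν x = 1) (η : ℝ) (A : ι → S → 𝔸) : commG₄ T U η A = 0 := by
  funext μ ν x
  simp only [commG₄, yP_eq_zero_of_plaqU_eq_one T U η (hflat μ ν x), mul_zero, zero_mul, sub_zero, smul_zero, Pi.zero_apply]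

variable [Fintype ι] [LinearOrder ι]

omit [Algebra ℂ 𝔸] in
/-- The plaquette adjoint `D*` of (3.9) kills the zero plaquette function. [folklore] -/
theorem divP_zero (μ : ι) (x : S) : divP T U (0 : ι → ι → S → 𝔸) μ x = 0 := by
  simp [divP, covDstar]

omit [Algebra ℂ 𝔸] in
/-- The letter divergence kills four zero slots. [folklore] -/
theorem divL_zero (μ : ι) (x : S) : divL T U (0 : ι → ι → S → 𝔸) 0 0 0 μ x = 0 := by
  simp [divL]

/-- ★ **AT A FLAT BACKGROUND THE CURVATURE PART OF THE WILSON HESSIAN VANISHES IDENTICALLY: `Δ′_U A ≡ 0` whenever `U(∂p) = 1` for every plaquette** — the general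
flat-background edition of lit's closing `example` ∕ ✓`Prop7LaplaceAFlatLetters.deltaPrimeOp_one` (there `U ≡ 1`). [cite: Balaban1985BackgroundPropagators, (3.10) p.392] -/
theorem deltaPrimeOp_eq_zero_of_flat (hflat : ∀ μ ν x, plaqU T U μ ν x = 1) (η : ℝ) (A : ι → S → 𝔸) (μ : ι) (x : S) :
    deltaPrimeOp T U η A μ x = 0 := by
  rw [deltaPrimeOp, jordanF_eq_zero_of_flat hflat, commG₁_eq_zero_of_flat hflat, commG₂_eq_zero_of_flat hflat, commG₃_eq_zero_of_flat hflat,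
    commG₄_eq_zero_of_flat hflat, divP_zero, divL_zero, add_zero]

/-- ★ **HENCE `Δ^η(U) = D^{η*}D^η_U` AT A FLAT BACKGROUND** — (3.10) with no curvature part («the operator ∂*∂ in the Abelian case», now covariant).
[cite: Balaban1985BackgroundPropagators, (3.10) p.392] -/
theorem deltaOp_eq_of_flat (hflat : ∀ μ ν x, plaqU T U μ ν x = 1) (η : ℝ) (A : ι → S → 𝔸) (μ : ι) (x : S) :
    deltaOp T U η A μ x = divPη T U η (curlη T U η A) μ x := by
  rw [deltaOp, deltaPrimeOp_eq_zero_of_flat hflat, add_zero]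

end B9Letters

/-! ## §2 The member's Hessian `Δ^η_W` at a flat background `W` -/

section Member

variable {F : T3Family} {n K : ℕ} {c₀ : ℝ}

/-- **THE FLATNESS LETTER FROM THE HOLONOMY LETTER**: if the plaquette field `plaqFT (W♭)` of the background (the letter of `RegPr`'s plaquette clause, ✓`val_plaqU_torusT_eq_plaqFT`)
is identically `1`, then every [B9] plaquette variable `U(∂p)` of `U := fun μ x ↦ W♭⟨x, μ⟩` is the unit. [cite: Balaban1985BackgroundPropagators, (3.1) p.390; Balaban1985Averaging, (9) p.19] -/
theorem plaqU_bgUnits_eq_one_of_plaqFT (W : GaugeField (F.P K) 0 (Matrix.specialUnitaryGroup (Fin 2) ℂ))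
    (hFT : ∀ μ ν x, plaqFT (bgUnits F K W) μ ν x = 1) (μ ν : Fin (F.P K).d) (x : Site (F.P K) 0) :
    plaqU (torusT (F.P K) 0) (fun μ x => bgUnits F K W ⟨x, μ⟩) μ ν x = 1 :=
  Units.ext (by rw [val_plaqU_torusT_eq_plaqFT, hFT, Units.val_one])

variable [Fact (0 < c₀)]

/-- ★★ **`Δ^η_W(toL2 X) = toL2 (η⁻² • D¹*_WD¹_W X)` AT A FLAT BACKGROUND** — ✓`Prop7SlotRowOfDeltaEta.DeltaEta_toL2_eq_toL2` with the curvature part `Δ′₁ = 0` (§1).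
[cite: Balaban1985BackgroundPropagators, (3.10) p.392] -/
theorem DeltaEta_toL2_eq_of_flat (W : GaugeField (F.P K) 0 (Matrix.specialUnitaryGroup (Fin 2) ℂ))
    (hflat : ∀ μ ν x, plaqU (torusT (F.P K) 0) (fun μ x => bgUnits F K W ⟨x, μ⟩) μ ν x = 1) (X : PBond (F.P K) 0 → Matrix (Fin 2) (Fin 2) ℂ) :
    DeltaEta F n K c₀ W (toL2 F K c₀ X)
      = toL2 F K c₀ (fun b => ((((eta F n K)⁻¹ ^ 2 : ℝ) : ℂ)) • covCodiffCurlT 1 (bgUnits F K W) X b.dir b.src) := by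
  rw [DeltaEta_toL2_eq_toL2]
  congr 1
  funext b
  rw [deltaPrimeOp_eq_zero_of_flat hflat, add_zero]

/-- ★★★ **THE WILSON HESSIAN AT A FLAT BACKGROUND IS THE COVARIANT CURL FORM, EXACTLY**:
`re⟪toL2 X, Δ^η_W(toL2 X)⟫ = c₀·η⁻²·Σ_{p : Plaq} ‖frobEquiv⁻¹((D¹_W X)(p))‖²` whenever `W(∂p) = 1` for every plaquette — print's (3.10) `⟨A, ΔA⟩ = Σ_p η^d tr((D_UA)(p))² + ⟨A, Δ′A⟩`
with `Δ′ = 0`; the `W ≡ 1` instance is ✓`Prop7LaplaceAFlatLetters.re_inner_DeltaEta_one`. [cite: Balaban1985BackgroundPropagators, (3.10)–(3.11) p.392] -/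
theorem re_inner_DeltaEta_eq_curlForm_of_flat (W : GaugeField (F.P K) 0 (Matrix.specialUnitaryGroup (Fin 2) ℂ))
    (hflat : ∀ μ ν x, plaqU (torusT (F.P K) 0) (fun μ x => bgUnits F K W ⟨x, μ⟩) μ ν x = 1) (X : PBond (F.P K) 0 → Matrix (Fin 2) (Fin 2) ℂ) :
    RCLike.re ⟪toL2 F K c₀ X, DeltaEta F n K c₀ W (toL2 F K c₀ X)⟫_ℂ
      = c₀ * (eta F n K)⁻¹ ^ 2 *
        ∑ p : Plaq (F.P K) 0, ‖(frobEquiv.symm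
            (curl (torusT (F.P K) 0) (fun μ x => bgUnits F K W ⟨x, μ⟩) (formComp X) p.μ p.ν p.src) : W₂)‖ ^ 2 := by
  rw [re_inner_toL2_DeltaEta_eq]
  simp only [deltaPrimeOp_eq_zero_of_flat hflat, Matrix.mul_zero, Matrix.trace_zero, Finset.sum_const_zero, map_zero, add_zero]

/-- ★ **EXACT POSITIVITY OF THE WILSON HESSIAN AT EVERY FLAT BACKGROUND**: `0 ≤ re⟪toL2 X, Δ^η_W(toL2 X)⟫` (a sum of squares; no `O(ε₀)` defect as on `RegPr`).
[cite: Balaban1985BackgroundPropagators, (3.10) p.392] -/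
theorem re_inner_DeltaEta_nonneg_of_flat (W : GaugeField (F.P K) 0 (Matrix.specialUnitaryGroup (Fin 2) ℂ))
    (hflat : ∀ μ ν x, plaqU (torusT (F.P K) 0) (fun μ x => bgUnits F K W ⟨x, μ⟩) μ ν x = 1) (X : PBond (F.P K) 0 → Matrix (Fin 2) (Fin 2) ℂ) :
    0 ≤ RCLike.re ⟪toL2 F K c₀ X, DeltaEta F n K c₀ W (toL2 F K c₀ X)⟫_ℂ := by
  rw [re_inner_DeltaEta_eq_curlForm_of_flat W hflat X]
  have hc₀ : 0 < c₀ := Fact.out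
  positivity

end Member

/-! ## §3 The toron: a direction-diagonal unit background is flat, and its covariant curl is the twisted scalar curl entry by entry -/

section Toron

variable {F : T3Family} {n K : ℕ} {c₀ : ℝ}

/-- The unit letter at a direction-diagonal background: `↑(W♭⟨x, μ⟩) = diag(δ(μ))`. [cite: Balaban1985Averaging, (19) p.21] -/
theorem val_bgUnits_of_dirDiagonal (W : GaugeField (F.P K) 0 (Matrix.specialUnitaryGroup (Fin 2) ℂ)) (δ : Fin (F.P K).d → Fin 2 → ℂ)
    (hU : ∀ b, ((W b : Matrix.specialUnitaryGroup (Fin 2) ℂ) : Matrix (Fin 2) (Fin 2) ℂ) = Matrix.diagonal (δ b.dir)) (μ : Fin (F.P K).d) (x : Site (F.P K) 0) :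
    ((bgUnits F K W ⟨x, μ⟩ : (Matrix (Fin 2) (Fin 2) ℂ)ˣ) : Matrix (Fin 2) (Fin 2) ℂ) = Matrix.diagonal (δ μ) :=
  hU ⟨x, μ⟩

/-- … and its inverse: `↑(W♭⟨x, μ⟩)⁻¹ = (diag δ(μ))^*` ((3.5): the background is unitary, ✓`val_inv_bgUnits_eq_star`). [cite: Balaban1985BackgroundPropagators, (3.5) p.391] -/
theorem val_inv_bgUnits_of_dirDiagonal (W : GaugeField (F.P K) 0 (Matrix.specialUnitaryGroup (Fin 2) ℂ)) (δ : Fin (F.P K).d → Fin 2 → ℂ)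
    (hU : ∀ b, ((W b : Matrix.specialUnitaryGroup (Fin 2) ℂ) : Matrix (Fin 2) (Fin 2) ℂ) = Matrix.diagonal (δ b.dir)) (μ : Fin (F.P K).d) (x : Site (F.P K) 0) :
    (((bgUnits F K W ⟨x, μ⟩)⁻¹ : (Matrix (Fin 2) (Fin 2) ℂ)ˣ) : Matrix (Fin 2) (Fin 2) ℂ) = star (Matrix.diagonal (δ μ)) := by
  have h : (((bgUnits F K W ⟨x, μ⟩)⁻¹ : (Matrix (Fin 2) (Fin 2) ℂ)ˣ) : Matrix (Fin 2) (Fin 2) ℂ)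
      = star ((bgUnits F K W ⟨x, μ⟩ : (Matrix (Fin 2) (Fin 2) ℂ)ˣ) : Matrix (Fin 2) (Fin 2) ℂ) :=
    val_inv_bgUnits_eq_star W μ x
  rw [h, val_bgUnits_of_dirDiagonal W δ hU]

/-- ★ **A DIRECTION-DIAGONAL UNIT BACKGROUND IS FLAT**: if `↑(W⟨x, ν⟩) = diag(δ(ν))` with `|δ_i(ν)| = 1`, then `U(∂p) = diag(δ(μ))·diag(δ(ν))·diag(δ(μ))^*·diag(δ(ν))^* = 1`
for every plaquette (diagonal matrices commute). [cite: Balaban1985BackgroundPropagators, (3.1) p.390, (3.5) p.391] -/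
theorem plaqU_eq_one_of_dirDiagonal (W : GaugeField (F.P K) 0 (Matrix.specialUnitaryGroup (Fin 2) ℂ)) (δ : Fin (F.P K).d → Fin 2 → ℂ)
    (hU : ∀ b, ((W b : Matrix.specialUnitaryGroup (Fin 2) ℂ) : Matrix (Fin 2) (Fin 2) ℂ) = Matrix.diagonal (δ b.dir)) (hδ : ∀ ν i, ‖δ ν i‖ = 1)
    (μ ν : Fin (F.P K).d) (x : Site (F.P K) 0) :
    plaqU (torusT (F.P K) 0) (fun μ x => bgUnits F K W ⟨x, μ⟩) μ ν x = 1 := by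
  apply Units.ext
  simp only [plaqU, Units.val_mul, Units.val_one, val_bgUnits_of_dirDiagonal W δ hU, val_inv_bgUnits_of_dirDiagonal W δ hU,
    Matrix.star_eq_conjTranspose, Matrix.diagonal_conjTranspose, Matrix.diagonal_mul_diagonal, ← Matrix.diagonal_one]
  congr 1
  funext i
  simp only [Pi.star_apply]
  calc δ μ i * δ ν i * star (δ μ i) * star (δ ν i) = (δ μ i * star (δ μ i)) * (δ ν i * star (δ ν i)) := by ring
    _ = 1 := by rw [mul_conj_self_of_norm_eq_one (hδ μ) i, mul_conj_self_of_norm_eq_one (hδ ν) i, mul_one]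

/-- ★★ **THE COVARIANT CURL AT A TORON, ENTRY BY ENTRY**: with the unit twist `ω_{rs,κ} := δ_r(κ)·conj(δ_s(κ))`,
`((D¹_W X)(p_{μν}(x)))_{rs} = (ω_{rs,μ}·X(x+e_μ, ν)_{rs} − X(x, ν)_{rs}) − (ω_{rs,ν}·X(x+e_ν, μ)_{rs} − X(x, μ)_{rs})` — (3.4) `D_UA(p) = D_{U,μ}A_ν − D_{U,ν}A_μ` with each
covariant difference read through ✓`ToronSectorStencils.diagonal_conj_apply`. [cite: Balaban1985BackgroundPropagators, (3.3)–(3.4) pp.390–391; Balaban1984PropagatorsI, (1.31) p.23] -/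
theorem curl_apply_entry_of_dirDiagonal (W : GaugeField (F.P K) 0 (Matrix.specialUnitaryGroup (Fin 2) ℂ)) (δ : Fin (F.P K).d → Fin 2 → ℂ)
    (hU : ∀ b, ((W b : Matrix.specialUnitaryGroup (Fin 2) ℂ) : Matrix (Fin 2) (Fin 2) ℂ) = Matrix.diagonal (δ b.dir))
    (X : PBond (F.P K) 0 → Matrix (Fin 2) (Fin 2) ℂ) (μ ν : Fin (F.P K).d) (x : Site (F.P K) 0) (r s : Fin 2) :
    curl (torusT (F.P K) 0) (fun μ x => bgUnits F K W ⟨x, μ⟩) (formComp X) μ ν x r s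
      = (δ μ r * star (δ μ s) * X ⟨x.shift μ, ν⟩ r s - X ⟨x, ν⟩ r s)
          - (δ ν r * star (δ ν s) * X ⟨x.shift ν, μ⟩ r s - X ⟨x, μ⟩ r s) := by
  simp only [curl, covD, R, torusT_apply, formComp, Matrix.sub_apply, val_bgUnits_of_dirDiagonal W δ hU, val_inv_bgUnits_of_dirDiagonal W δ hU,
    diagonal_conj_apply]

/-- **THE DIAGONAL ENTRIES ARE FLAT**: with unit phases, `((D¹_W X)(p))_{rr} = (curl₁ X_{rr})(p)` — the FLAT curl `LatticeFieldCalculus.curl 1` of the scalar field `b ↦ X(b)_{rr}`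
(the trace ∕ `σ₃` sectors see no background). [cite: Balaban1985BackgroundPropagators, (3.4) p.391; Balaban1984PropagatorsI, (1.2) p.18] -/
theorem curl_apply_diagEntry_of_dirDiagonal (W : GaugeField (F.P K) 0 (Matrix.specialUnitaryGroup (Fin 2) ℂ)) (δ : Fin (F.P K).d → Fin 2 → ℂ)
    (hU : ∀ b, ((W b : Matrix.specialUnitaryGroup (Fin 2) ℂ) : Matrix (Fin 2) (Fin 2) ℂ) = Matrix.diagonal (δ b.dir)) (hδ : ∀ ν i, ‖δ ν i‖ = 1)
    (X : PBond (F.P K) 0 → Matrix (Fin 2) (Fin 2) ℂ) (μ ν : Fin (F.P K).d) (hμν : μ < ν) (x : Site (F.P K) 0) (r : Fin 2) :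
    curl (torusT (F.P K) 0) (fun μ x => bgUnits F K W ⟨x, μ⟩) (formComp X) μ ν x r r
      = LatticeFieldCalculus.curl 1 (fun b => X b r r) ⟨x, μ, ν, hμν⟩ := by
  rw [curl_apply_entry_of_dirDiagonal W δ hU, mul_conj_self_of_norm_eq_one (hδ μ) r, mul_conj_self_of_norm_eq_one (hδ ν) r, one_mul, one_mul,
    LatticeFieldCalculus.curl, one_smul]
  ring

variable [Fact (0 < c₀)]

/-- ★★★ **THE WILSON HESSIAN AT A TORON IS THE TWISTED SCALAR CURL FORM, ENTRY BY ENTRY**: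
`re⟪toL2 X, Δ^η_W(toL2 X)⟫ = c₀·η⁻²·Σ_{p = p_{μν}(x)} Σ_{r,s} |(ω_{rs,μ}X(x+e_μ,ν)_{rs} − X(x,ν)_{rs}) − (ω_{rs,ν}X(x+e_ν,μ)_{rs} − X(x,μ)_{rs})|²` for a direction-diagonal unit background
`↑(W⟨x, κ⟩) = diag(δ(κ))` — §2 at the flat background of `plaqU_eq_one_of_dirDiagonal`, the Frobenius square read entrywise (✓`Prop7RieszTauFrobNorm.norm_sq_frobEquiv_symm`), and
`curl_apply_entry_of_dirDiagonal`.  Each entry `(r, s)` is the quadratic form of the scalar operator whose `dftV` symbol px10's brick (1) computes (✓`ToronTwistedMultipliers`).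
[cite: Balaban1985BackgroundPropagators, (3.10) p.392; Balaban1984PropagatorsI, (1.29)–(1.31) p.23] -/
theorem re_inner_DeltaEta_eq_of_dirDiagonal (W : GaugeField (F.P K) 0 (Matrix.specialUnitaryGroup (Fin 2) ℂ)) (δ : Fin (F.P K).d → Fin 2 → ℂ)
    (hU : ∀ b, ((W b : Matrix.specialUnitaryGroup (Fin 2) ℂ) : Matrix (Fin 2) (Fin 2) ℂ) = Matrix.diagonal (δ b.dir)) (hδ : ∀ ν i, ‖δ ν i‖ = 1)
    (X : PBond (F.P K) 0 → Matrix (Fin 2) (Fin 2) ℂ) :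
    RCLike.re ⟪toL2 F K c₀ X, DeltaEta F n K c₀ W (toL2 F K c₀ X)⟫_ℂ
      = c₀ * (eta F n K)⁻¹ ^ 2 *
        ∑ p : Plaq (F.P K) 0, ∑ r : Fin 2, ∑ s : Fin 2,
          ‖(δ p.μ r * star (δ p.μ s) * X ⟨p.src.shift p.μ, p.ν⟩ r s - X ⟨p.src, p.ν⟩ r s)
              - (δ p.ν r * star (δ p.ν s) * X ⟨p.src.shift p.ν, p.μ⟩ r s - X ⟨p.src, p.μ⟩ r s)‖ ^ 2 := by
  rw [re_inner_DeltaEta_eq_curlForm_of_flat W (plaqU_eq_one_of_dirDiagonal W δ hU hδ) X]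
  congr 1
  refine Finset.sum_congr rfl fun p _ => ?_
  rw [norm_sq_frobEquiv_symm]
  simp only [curl_apply_entry_of_dirDiagonal W δ hU]

end Toron

end Summit.QuantumFields.YangMills.Theorems.FlatBackgroundWilsonHessian

end
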